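import Literature.MathematicalPhysics.QuantumFieldTheory.Balaban1983to89.B1TorusRegionCubes
import Literature.MathematicalPhysics.QuantumFieldTheory.Balaban1983to89.B1Ineq225DecayBackgroundTorus
import Literature.MathematicalPhysics.QuantumFieldTheory.Balaban1983to89.B4RandomWalk213

/-!
# `Balaban1983to89.B1TorusLabelWalk` — [Balaban1983RegularityDecay] (2.13) p. 577 «the points ω_i, ω_{i+1} are vertices of a unit cube of
# the lattice» and (2.19)/(2.22) pp. 578–579 ON THE LABEL TORUS of the cube cover of `T_ε` ([Balaban1982Higgs1] Prop. 2.1): the adjacency of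
# cube labels, its `3^d` out-degree, the rule `h_ih_j ≠ 0 ⇒ i, j adjacent`, and the two geometric facts the walk expansion needs for a region —
# walks of `n` steps move the centre by `≤ 2nM` (the separation count behind `e^{−δ₀ dist(x, supp f)}`) and walks of `< n₀` steps from `x` stay
# inside `{dist(·, x) ≤ R₀} ⊂ Ω` («the condition dist({x, x′}, Ω^c) ≥ R₀, together with the definition (2.19) of R₀ imply that all □_{ω_i} are
# cubes contained in Ω»)

statement-level skeleton of published theorems with citation tags; proofs where landed; nothing here is a claim about the Yang–Mills mass gap

PDF held: `paper:balaban1983-cmp89-regularity-decay` pp. 577–579 [PDF 7–9] (text layer and the ×2 renders `…-p008-x2.png`, `…-p009-x2.png`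
re-read at gen 13 for the quotation docfix S-B1-g45-2 of ref-4 gen 45: the two sentences previously given in guillemets for pp. 578–579 were
not the printed ones and are replaced below by the printed (2.19) and p. 579 sentences; no declaration changed); `paper:balaban1982-cmp85-higgs23-i`
p. 610 [PDF 8].

CITATION HEADER (lean-in-tree rule).  T. Bałaban, *Regularity and decay of lattice Green's functions*, Commun. Math. Phys. **89** (1983)
571–597 [Balaban1983RegularityDecay] ((2.13) p. 577, (2.19) p. 578, (2.22) p. 579) and T. Bałaban, *(Higgs)₂,₃ quantum fields in a finite
volume. I*, Commun. Math. Phys. **85** (1982) 603–626 [Balaban1982Higgs1] ((1.3) p. 604, Prop. 2.1 p. 610).  Cell `lit-balaban` (HOME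
`run/shared/lean/pub/lit-balaban/`), Phase-2 proof seat **p35** gen 12 (unit `lit-balaban-p35`); SKELETON rows **B4.Eq2.13** (the walk
space: model instance on the label torus of `T_ε`), **B4.Eq2.19**/**B4.Eq2.22** (the `R₀` restriction and the separation count), feeding
**B1.Prop2.1** for regions on the concrete carrier.  USED BY NAME, never restated: gen 8's `B1TorusCubeCover` (`Lab`, `nLab`, `half`, `ctr`,
`Near`, `cube`, `nLab_mul_half`), `B1TorusCubeLocality26` (`rS`, `rS_succ_lt_half`), gen 10's `B1Ineq225DecayBackgroundTorus.tdist_le_of_near`,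
r14's `B1Ineq234LevelZero.{tdist_comm, tdist_triangle_real}`, `B1Ineq234Concrete.tdist_self`, r01's `B4RandomWalk213.{IsWalk, lastPt}`.

WHAT IS PRINTED.  p. 577: *«Let us consider a space of paths ω, each path is a sequence of points ω = {ω₀, ω₁, …, ω_n}, ω_i ∈ Z^d, satisfying
the following condition: the points ω_i, ω_{i+1} are vertices of a unit cube of the lattice. … and this representation follows from (2.12) and
the obvious fact that G_k(□_j, Ã_j)h_jK_{j′}G_k(□_{j′}, Ã_{j′}) = 0, if |j − j′| = max_μ|j_μ − j′_μ| > 1.»*; p. 578: *«Let us now take a positive integer n₀, we will fix it later, and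
let us define R₀ as R₀ = (diameter of ⋃_{ω=(ω₀,…,ω_{n₀}), ω₀=0} ⋃_{i=1}^{n₀} □_{ω_i}) + 2M. (2.19) Here □_j denotes a cube with center Mj and
size equal to 2M. From this definition it follows that R₀ depends on M and n₀. … The first is finite and the condition dist({x, x′}, Ω^c) ≥ R₀,
together with the definition (2.19) of R₀ imply that all □_{ω_i} are cubes contained in Ω.»*; p. 579: *«The summation in (2.18) is restricted
to paths ω satisfying x, x′ ∈ □_{ω₀}, supp f ⊂ □_{ω_n}, so the length n satisfies n ≥ M⁻¹dist({x, x′}, supp f) − 2. There are at most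
2^d(3^d)^{n−1}2^d of such paths»*.

WHAT THIS FILE PROVES (kernel-checked, zero `sorry`; two definitions with bodies + theorems; no `Prop` fact).
* §1 `centerSite j` (the site `Mj` of `T_ε`), `near_center` (`Mj` is within any `r` of itself), `near_half_of_mem_cube` (`□_j ⊂ {|x − Mj| ≤ M}`).
* §2 **`LAdj i l`** — `|i − j| = max_μ|i_μ − j_μ| ≤ 1` ON THE LABEL TORUS `Π_μ ℤ/N_μ` (coordinatewise `i_μ − l_μ ≡ −1, 0, 1 mod N_μ`; decidable,
  symmetric); **`ladj_of_near_near`** (`h_ih_j ≠ 0 ⇒ |i − j| ≤ 1`: two labels with a common site within `rS` of both centres are adjacent,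
  `K₀ ≥ 8`); `near_center_of_ladj` (adjacent centres are within `M` of each other); **`card_filter_ladj_le`** (out-degree `≤ 3^d`).
* §3 WALKS (`B4RandomWalk213.IsWalk LAdj`): `tdist_centers_le_of_ladj` (`≤ 2M`), **`tdist_walk_le`** (after `t + 1` steps the centre has moved
  `≤ 2M(t+1)` in the (1.3) distance), **`tdist_le_of_walk_near`** (`x` within `rS` of the start, `y` within `rS` of the end of an `n`-step walk ⇒
  `|x − y| ≤ 4rS + 2Mn` — the separation count of (2.22)), **`cube_subset_of_walk`** (if every site within `R` of `x` lies in `Ω` and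
  `2rS + 2M(t+2) ≤ R`, the cube of the `t`-th point of a walk started within `rS` of `x` lies in `Ω` — the `R₀` restriction (2.19) in site form).
HONEST SCOPE.  Label-torus geometry only (crude factors `2` from `tdist_le_of_near`); the (1.3) distance `tdist` in lattice units of `T_ε`; nothing
of (2.12), (2.18)–(2.21) is summed here.  Unit `lit-balaban-p35` gen 12 (literature-prover-lit-balaban-p35-g12-0).
-/

open scoped BigOperators

noncomputable section

namespace Literature.MathematicalPhysics.QuantumFieldTheory.Balaban1983to89.B1TorusLabelWalk

open Literature.MathematicalPhysics.QuantumFieldTheory.Balaban1983to89.HiggsLattice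
open Literature.MathematicalPhysics.QuantumFieldTheory.Balaban1983to89.B1TorusCubeCover
open Literature.MathematicalPhysics.QuantumFieldTheory.Balaban1983to89.B1TorusCubeLocality26 (rS rS_succ_lt_half)
open Literature.MathematicalPhysics.QuantumFieldTheory.Balaban1983to89.B1Ineq225DecayBackgroundTorus (tdist_le_of_near)
open Literature.MathematicalPhysics.QuantumFieldTheory.Balaban1983to89.B1Ineq234LevelZero (tdist_comm tdist_triangle_real)
open Literature.MathematicalPhysics.QuantumFieldTheory.Balaban1983to89.B1Ineq234Concrete (tdist_self)
open Literature.MathematicalPhysics.QuantumFieldTheory.Balaban1983to89.B4RandomWalk213 (IsWalk lastPt)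

variable {P : HiggsLattice.Params}

/-! ## §1 The centres `Mj` as sites of `T_ε` -/

section Centers

variable (K K₀ : ℕ)

/-- **THE CENTRE `Mj` OF THE CUBE `□_j` AS A SITE OF `T_ε`** (coordinates `M·j_μ mod |T_ε|_μ`). [cite: Balaban1983RegularityDecay, §2 p.575] -/
def centerSite (j : Lab P K K₀) : HiggsLattice.Site P 0 := fun μ => ((ctr K K₀ j μ : ℤ) : ZMod (P.sitesPerDir 0 μ))

variable {K K₀}

/-- `Mj` is within every radius `r` of itself. [cite: Balaban1983RegularityDecay, §2 p.575] -/
theorem near_center (r : ℕ) (j : Lab P K K₀) : Near K K₀ r j (centerSite K K₀ j) :=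
  fun μ => ⟨0, by simp, by simp [centerSite]⟩

/-- The window `□_j = Mj − M + [0, 2M)^d` lies within `M` of its centre. [cite: Balaban1983RegularityDecay, §2 p.575] -/
theorem near_half_of_mem_cube {j : Lab P K K₀} {x : HiggsLattice.Site P 0} (hx : x ∈ cube K K₀ j) : Near K K₀ (half P K K₀) j x := by
  intro μ
  obtain ⟨z, hz, e⟩ := (mem_cube.1 hx) μ
  rw [Finset.mem_Ico] at hz
  exact ⟨z, Finset.mem_Icc.2 ⟨hz.1, hz.2.le⟩, e⟩

end Centers

/-! ## §2 Adjacency on the label torus -/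

section Adjacency

variable (K K₀ : ℕ)

/-- **`|i − j| = max_μ |i_μ − j_μ| ≤ 1` ON THE LABEL TORUS** `Π_μ ℤ/N_μℤ` of the cube cover of `T_ε`: in every direction the labels differ by
`−1`, `0` or `1` modulo `N_μ`. [cite: Balaban1983RegularityDecay, (2.13) p.577] -/
def LAdj (i l : Lab P K K₀) : Prop :=
  ∀ μ, ∃ e ∈ ({-1, 0, 1} : Finset ℤ), ((nLab P K K₀ μ : ℕ) : ℤ) ∣ ((i μ : ℕ) : ℤ) - ((l μ : ℕ) : ℤ) - e

/-- `LAdj` is decidable (the walks over it form `Finset`s). [folklore] -/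
instance instDecidableRelLAdj : DecidableRel (LAdj (P := P) K K₀) := fun i l => by
  unfold LAdj; infer_instance

variable {K K₀}

/-- Adjacency is symmetric. [cite: Balaban1983RegularityDecay, (2.13) p.577] -/
theorem ladj_symm {i l : Lab P K K₀} (h : LAdj K K₀ i l) : LAdj K K₀ l i := by
  intro μ
  obtain ⟨e, he, hd⟩ := h μ
  refine ⟨-e, ?_, ?_⟩
  · simp only [Finset.mem_insert, Finset.mem_singleton] at he ⊢
    rcases he with h | h | h <;> simp [h]
  · have : ((l μ : ℕ) : ℤ) - ((i μ : ℕ) : ℤ) - -e = -((((i μ : ℕ) : ℤ)) - ((l μ : ℕ) : ℤ) - e) := by ring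
    rw [this]
    exact hd.neg_right

/-- Every label is adjacent to itself. [cite: Balaban1983RegularityDecay, (2.13) p.577] -/
theorem ladj_refl (i : Lab P K K₀) : LAdj K K₀ i i := fun μ => ⟨0, by simp, by simp⟩

/-- **The adjacency behind «G_k(□_j, Ã_j)h_jK_{j′}G_k(□_{j′}, Ã_{j′}) = 0, if |j − j′| = max_μ|j_μ − j′_μ| > 1»**: two labels whose `rS`-cores
share a site are adjacent (`K ≤ K_P`, `K₀ ∣ M_P`, `K₀ ≥ 8`, so `2rS < 2M`:
the two centre representations of the common site differ by a multiple of `M` of size `< 2M` modulo `|T_ε|_μ = N_μM`).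
[cite: Balaban1983RegularityDecay, (2.13) p.577] -/
theorem ladj_of_near_near (hK : K ≤ P.K) (hK₀ : K₀ ∣ P.M) (hK₀8 : 8 ≤ K₀) {i l : Lab P K K₀} {x : HiggsLattice.Site P 0}
    (hi : Near K K₀ (rS P K K₀) i x) (hl : Near K K₀ (rS P K K₀) l x) : LAdj K K₀ i l := by
  have hK₀' : 1 ≤ K₀ := le_trans (by norm_num) hK₀8
  have hh : 0 < half P K K₀ := half_pos hK₀'
  have hrs : rS P K K₀ + 1 < half P K K₀ := rS_succ_lt_half hK₀8
  intro μ
  obtain ⟨z₁, hz₁, e₁⟩ := hi μ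
  obtain ⟨z₂, hz₂, e₂⟩ := hl μ
  rw [Finset.mem_Icc] at hz₁ hz₂
  have hS : ((nLab P K K₀ μ : ℕ) : ℤ) * (half P K K₀ : ℤ) = (P.sitesPerDir 0 μ : ℤ) := by
    rw [← nLab_mul_half hK hK₀ μ]; push_cast; ring
  -- the two representations of `x_μ` agree modulo `|T_ε|_μ`
  have hdvd : (P.sitesPerDir 0 μ : ℤ) ∣ (ctr K K₀ l μ + z₂) - (ctr K K₀ i μ + z₁) :=
    (ZMod.intCast_eq_intCast_iff_dvd_sub _ _ _).1 (e₁.symm.trans e₂)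
  rw [← hS] at hdvd
  unfold ctr at hdvd
  -- `half ∣ w` for `w = z₂ − z₁`, `|w| < 2·half`
  set w : ℤ := z₂ - z₁ with hw
  have hw2 : |w| < 2 * (half P K K₀ : ℤ) := by
    rw [abs_lt]; constructor <;> omega
  have hhalf_dvd : (half P K K₀ : ℤ) ∣ w := by
    have h1 : (half P K K₀ : ℤ) ∣ (half P K K₀ : ℤ) * ((l μ : ℕ) : ℤ) + z₂ - ((half P K K₀ : ℤ) * ((i μ : ℕ) : ℤ) + z₁) :=
      (Dvd.intro_left _ rfl).trans hdvd
    have e : w = (half P K K₀ : ℤ) * ((l μ : ℕ) : ℤ) + z₂ - ((half P K K₀ : ℤ) * ((i μ : ℕ) : ℤ) + z₁)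
        - (half P K K₀ : ℤ) * (((l μ : ℕ) : ℤ) - ((i μ : ℕ) : ℤ)) := by rw [hw]; ring
    rw [e]
    exact h1.sub (Dvd.intro _ rfl)
  obtain ⟨e, he⟩ := hhalf_dvd
  have he1 : |e| ≤ 1 := by
    have h1 : |w| = (half P K K₀ : ℤ) * |e| := by rw [he, abs_mul, abs_of_pos (by exact_mod_cast hh)]
    rw [h1] at hw2
    have : |e| < 2 := by
      by_contra hc
      push Not at hc
      have : 2 * (half P K K₀ : ℤ) ≤ (half P K K₀ : ℤ) * |e| := by nlinarith
      linarith
    omega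
  refine ⟨e, ?_, ?_⟩
  · simp only [Finset.mem_insert, Finset.mem_singleton]
    rcases abs_le.1 he1 with ⟨h1, h2⟩
    omega
  · -- `N_μ·half ∣ half·(l − i) + half·e = half·(l − i + e)`
    have h2 : ((nLab P K K₀ μ : ℕ) : ℤ) * (half P K K₀ : ℤ) ∣ (half P K K₀ : ℤ) * (((l μ : ℕ) : ℤ) - ((i μ : ℕ) : ℤ) + e) := by
      have e' : (half P K K₀ : ℤ) * (((l μ : ℕ) : ℤ) - ((i μ : ℕ) : ℤ) + e)
          = (half P K K₀ : ℤ) * ((l μ : ℕ) : ℤ) + z₂ - ((half P K K₀ : ℤ) * ((i μ : ℕ) : ℤ) + z₁) := by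
        rw [show z₂ = w + z₁ by rw [hw]; ring, he]; ring
      rw [e']; exact hdvd
    rw [mul_comm ((nLab P K K₀ μ : ℕ) : ℤ)] at h2
    have h3 : ((nLab P K K₀ μ : ℕ) : ℤ) ∣ ((l μ : ℕ) : ℤ) - ((i μ : ℕ) : ℤ) + e :=
      (mul_dvd_mul_iff_left (by exact_mod_cast hh.ne')).1 h2
    have e'' : ((i μ : ℕ) : ℤ) - ((l μ : ℕ) : ℤ) - e = -(((l μ : ℕ) : ℤ) - ((i μ : ℕ) : ℤ) + e) := by ring
    rw [e'']
    exact h3.neg_right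

/-- Adjacent labels have centres within `M` of each other: `Ml` is within `M` of `Mi` coordinatewise. [cite: Balaban1983RegularityDecay, (2.13) p.577] -/
theorem near_center_of_ladj (hK : K ≤ P.K) (hK₀ : K₀ ∣ P.M) {i l : Lab P K K₀} (h : LAdj K K₀ i l) :
    Near K K₀ (half P K K₀) i (centerSite K K₀ l) := by
  intro μ
  obtain ⟨e, he, hd⟩ := h μ
  have he1 : -1 ≤ e ∧ e ≤ 1 := by
    simp only [Finset.mem_insert, Finset.mem_singleton] at he
    rcases he with h | h | h <;> subst h <;> norm_num
  refine ⟨-(half P K K₀ : ℤ) * e, ?_, ?_⟩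
  · rw [Finset.mem_Icc]
    constructor <;> nlinarith [he1.1, he1.2, (Nat.cast_nonneg (half P K K₀) : (0 : ℤ) ≤ half P K K₀)]
  · show ((ctr K K₀ l μ : ℤ) : ZMod (P.sitesPerDir 0 μ)) = _
    rw [ZMod.intCast_eq_intCast_iff_dvd_sub]
    have hS : ((nLab P K K₀ μ : ℕ) : ℤ) * (half P K K₀ : ℤ) = (P.sitesPerDir 0 μ : ℤ) := by
      rw [← nLab_mul_half hK hK₀ μ]; push_cast; ring
    rw [← hS]
    unfold ctr
    have e' : (half P K K₀ : ℤ) * ((i μ : ℕ) : ℤ) + -(half P K K₀ : ℤ) * e - (half P K K₀ : ℤ) * ((l μ : ℕ) : ℤ)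
        = (half P K K₀ : ℤ) * (((i μ : ℕ) : ℤ) - ((l μ : ℕ) : ℤ) - e) := by ring
    rw [e', mul_comm ((nLab P K K₀ μ : ℕ) : ℤ)]
    exact mul_dvd_mul_left _ hd

/-- **THE OUT-DEGREE OF THE LABEL ADJACENCY IS `≤ 3^d`** (the labels adjacent to `j` are among `j + e`, `e ∈ {−1, 0, 1}^d`).
[cite: Balaban1983RegularityDecay, (2.13) p.577, (2.22) p.579] -/
theorem card_filter_ladj_le (hK : K ≤ P.K) (hK₀ : K₀ ∣ P.M) (hK₀' : 1 ≤ K₀) (j : Lab P K K₀) :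
    (Finset.univ.filter fun l : Lab P K K₀ => LAdj K K₀ j l).card ≤ 3 ^ P.d := by
  classical
  have hn : ∀ μ, 0 < nLab P K K₀ μ := fun μ => lt_of_lt_of_le (by norm_num) (two_le_nLab hK hK₀ hK₀' μ)
  -- the candidate in direction `μ` for the shift `e`
  let f : (μ : Fin P.d) → ℤ → Fin (nLab P K K₀ μ) := fun μ e =>
    ⟨((((j μ : ℕ) : ℤ) - e) % (nLab P K K₀ μ : ℤ)).toNat, by
      have h0 : (0 : ℤ) < nLab P K K₀ μ := by exact_mod_cast hn μ
      have h1 := Int.emod_lt_of_pos (((j μ : ℕ) : ℤ) - e) h0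
      have h2 := Int.emod_nonneg (((j μ : ℕ) : ℤ) - e) h0.ne'
      omega⟩
  have hsub : (Finset.univ.filter fun l : Lab P K K₀ => LAdj K K₀ j l)
      ⊆ Fintype.piFinset fun μ => ({-1, 0, 1} : Finset ℤ).image (f μ) := by
    intro l hl
    rw [Finset.mem_filter] at hl
    rw [Fintype.mem_piFinset]
    intro μ
    obtain ⟨e, he, hd⟩ := hl.2 μ
    rw [Finset.mem_image]
    refine ⟨e, he, ?_⟩
    apply Fin.ext
    show ((((j μ : ℕ) : ℤ) - e) % (nLab P K K₀ μ : ℤ)).toNat = (l μ : ℕ)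
    have h0 : (0 : ℤ) < nLab P K K₀ μ := by exact_mod_cast hn μ
    have hmod : (((j μ : ℕ) : ℤ) - e) % (nLab P K K₀ μ : ℤ) = ((l μ : ℕ) : ℤ) := by
      have hme : ((l μ : ℕ) : ℤ) % (nLab P K K₀ μ : ℤ) = (((j μ : ℕ) : ℤ) - e) % (nLab P K K₀ μ : ℤ) :=
        Int.modEq_iff_dvd.2 (by
          have : ((j μ : ℕ) : ℤ) - e - ((l μ : ℕ) : ℤ) = ((j μ : ℕ) : ℤ) - ((l μ : ℕ) : ℤ) - e := by ring
          rw [this]; exact hd)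
      rw [← hme, Int.emod_eq_of_lt (by positivity) (by exact_mod_cast (l μ).isLt)]
    rw [hmod, Int.toNat_natCast]
  refine (Finset.card_le_card hsub).trans ?_
  rw [Fintype.card_piFinset]
  calc ∏ μ : Fin P.d, (({-1, 0, 1} : Finset ℤ).image (f μ)).card ≤ ∏ _μ : Fin P.d, 3 :=
        Finset.prod_le_prod (fun μ _ => Nat.zero_le _) fun μ _ => Finset.card_image_le.trans (by decide)
    _ = 3 ^ P.d := by rw [Finset.prod_const, Finset.card_univ, Fintype.card_fin]

end Adjacency

/-! ## §3 Walks on the label torus -/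

section Walks

variable {K K₀ : ℕ}

/-- Adjacent centres are at (1.3)-distance `≤ 2M`. [cite: Balaban1983RegularityDecay, (2.22) p.579] -/
theorem tdist_centers_le_of_ladj (hK : K ≤ P.K) (hK₀ : K₀ ∣ P.M) {i l : Lab P K K₀} (h : LAdj K K₀ i l) :
    HiggsLattice.Site.tdist (centerSite K K₀ i) (centerSite K K₀ l) ≤ 2 * half P K K₀ :=
  tdist_le_of_near (near_center _ i) (near_center_of_ladj hK hK₀ h)

/-- **AFTER `t + 1` STEPS OF A WALK THE CENTRE HAS MOVED BY `≤ 2M(t+1)`** in the (1.3) distance. [cite: Balaban1983RegularityDecay, (2.22) p.579] -/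
theorem tdist_walk_le (hK : K ≤ P.K) (hK₀ : K₀ ∣ P.M) {n : ℕ} {i : Lab P K K₀} {ys : Fin n → Lab P K K₀}
    (hw : IsWalk (LAdj K K₀) i ys) :
    ∀ (t : ℕ) (ht : t < n), HiggsLattice.Site.tdist (centerSite K K₀ i) (centerSite K K₀ (ys ⟨t, ht⟩)) ≤ 2 * half P K K₀ * (t + 1)
  | 0, ht => by
    have h : LAdj K K₀ i (ys ⟨0, ht⟩) := hw ⟨0, ht⟩
    simpa using tdist_centers_le_of_ladj hK hK₀ h
  | t + 1, ht => by
    have h : LAdj K K₀ (ys ⟨t, Nat.lt_of_succ_lt ht⟩) (ys ⟨t + 1, ht⟩) := hw ⟨t + 1, ht⟩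
    have h1 := tdist_walk_le hK hK₀ hw t (Nat.lt_of_succ_lt ht)
    have h2 := tdist_centers_le_of_ladj hK hK₀ h
    have h3 : (HiggsLattice.Site.tdist (centerSite K K₀ i) (centerSite K K₀ (ys ⟨t + 1, ht⟩)) : ℝ)
        ≤ HiggsLattice.Site.tdist (centerSite K K₀ i) (centerSite K K₀ (ys ⟨t, Nat.lt_of_succ_lt ht⟩))
          + HiggsLattice.Site.tdist (centerSite K K₀ (ys ⟨t, Nat.lt_of_succ_lt ht⟩)) (centerSite K K₀ (ys ⟨t + 1, ht⟩)) :=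
      tdist_triangle_real _ _ _
    have h4 : HiggsLattice.Site.tdist (centerSite K K₀ i) (centerSite K K₀ (ys ⟨t + 1, ht⟩))
        ≤ HiggsLattice.Site.tdist (centerSite K K₀ i) (centerSite K K₀ (ys ⟨t, Nat.lt_of_succ_lt ht⟩))
          + HiggsLattice.Site.tdist (centerSite K K₀ (ys ⟨t, Nat.lt_of_succ_lt ht⟩)) (centerSite K K₀ (ys ⟨t + 1, ht⟩)) := by
      exact_mod_cast h3
    calc _ ≤ _ := h4
      _ ≤ 2 * half P K K₀ * (t + 1) + 2 * half P K K₀ := add_le_add h1 h2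
      _ = 2 * half P K K₀ * (t + 1 + 1) := by ring

/-- The end-point version: the centre of `lastPt` of an `n`-step walk is within `2Mn` of the start. [cite: Balaban1983RegularityDecay, (2.22) p.579] -/
theorem tdist_lastPt_le (hK : K ≤ P.K) (hK₀ : K₀ ∣ P.M) {n : ℕ} {i : Lab P K K₀} {ys : Fin n → Lab P K K₀}
    (hw : IsWalk (LAdj K K₀) i ys) :
    HiggsLattice.Site.tdist (centerSite K K₀ i) (centerSite K K₀ (lastPt i n ys)) ≤ 2 * half P K K₀ * n := by
  cases n with
  | zero => simp [lastPt, tdist_self]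
  | succ m =>
    have h := tdist_walk_le hK hK₀ hw m (Nat.lt_succ_self m)
    have e : (lastPt i (m + 1) ys) = ys ⟨m, Nat.lt_succ_self m⟩ := rfl
    rw [e]
    simpa using h

/-- **THE SEPARATION COUNT OF (2.22)**: if `x` is within `rS` of the start and `y` within `rS` of the end of an `n`-step walk, then
`|x − y| ≤ 4rS + 2Mn` — so a walk whose letters connect `x` to `supp f` has at least `(dist(x, supp f) − 4rS)/(2M)` steps.
[cite: Balaban1983RegularityDecay, (2.22) p.579] -/
theorem tdist_le_of_walk_near (hK : K ≤ P.K) (hK₀ : K₀ ∣ P.M) {n : ℕ} {i : Lab P K K₀} {ys : Fin n → Lab P K K₀}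
    (hw : IsWalk (LAdj K K₀) i ys) {x y : HiggsLattice.Site P 0} (hx : Near K K₀ (rS P K K₀) i x)
    (hy : Near K K₀ (rS P K K₀) (lastPt i n ys) y) :
    HiggsLattice.Site.tdist x y ≤ 4 * rS P K K₀ + 2 * half P K K₀ * n := by
  have h1 : HiggsLattice.Site.tdist x (centerSite K K₀ i) ≤ 2 * rS P K K₀ := tdist_le_of_near hx (near_center _ i)
  have h2 := tdist_lastPt_le hK hK₀ hw
  have h3 : HiggsLattice.Site.tdist (centerSite K K₀ (lastPt i n ys)) y ≤ 2 * rS P K K₀ := tdist_le_of_near (near_center _ _) hy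
  have t1 := tdist_triangle_real x (centerSite K K₀ i) y
  have t2 := tdist_triangle_real (centerSite K K₀ i) (centerSite K K₀ (lastPt i n ys)) y
  have h : (HiggsLattice.Site.tdist x y : ℝ) ≤ 4 * rS P K K₀ + 2 * half P K K₀ * n := by
    have h1' : (HiggsLattice.Site.tdist x (centerSite K K₀ i) : ℝ) ≤ 2 * rS P K K₀ := by exact_mod_cast h1
    have h2' : (HiggsLattice.Site.tdist (centerSite K K₀ i) (centerSite K K₀ (lastPt i n ys)) : ℝ) ≤ 2 * half P K K₀ * n := by
      exact_mod_cast h2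
    have h3' : (HiggsLattice.Site.tdist (centerSite K K₀ (lastPt i n ys)) y : ℝ) ≤ 2 * rS P K K₀ := by exact_mod_cast h3
    linarith
  exact_mod_cast h

/-- **THE `R₀` RESTRICTION (2.19) IN SITE FORM**: if every site within (1.3)-distance `R` of `x` lies in `Ω`, `x` is within `rS` of the
start of a walk, and `2rS + 2M(t + 2) ≤ R`, then the cube of the `t`-th point of the walk lies in `Ω` (an interior cube: «all □_{ω_i} are cubes
contained in Ω»). [cite: Balaban1983RegularityDecay, (2.19) p.578] -/
theorem cube_subset_of_walk (hK : K ≤ P.K) (hK₀ : K₀ ∣ P.M) {Ω : Finset (HiggsLattice.Site P 0)} {x : HiggsLattice.Site P 0}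
    {R : ℕ} (hR : ∀ y, HiggsLattice.Site.tdist x y ≤ R → y ∈ Ω) {n : ℕ} {i : Lab P K K₀} {ys : Fin n → Lab P K K₀}
    (hw : IsWalk (LAdj K K₀) i ys) (hx : Near K K₀ (rS P K K₀) i x) (t : Fin n)
    (ht : 2 * rS P K K₀ + 2 * half P K K₀ * (t + 2) ≤ R) : cube K K₀ (ys t) ⊆ Ω := by
  intro y hy
  apply hR
  have h1 : HiggsLattice.Site.tdist x (centerSite K K₀ i) ≤ 2 * rS P K K₀ := tdist_le_of_near hx (near_center _ i)
  have h2 := tdist_walk_le hK hK₀ hw t.1 t.2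
  have h3 : HiggsLattice.Site.tdist (centerSite K K₀ (ys t)) y ≤ 2 * half P K K₀ :=
    tdist_le_of_near (near_center _ _) (near_half_of_mem_cube hy)
  have t1 := tdist_triangle_real x (centerSite K K₀ i) y
  have t2 := tdist_triangle_real (centerSite K K₀ i) (centerSite K K₀ (ys t)) y
  have h : (HiggsLattice.Site.tdist x y : ℝ) ≤ R := by
    have h1' : (HiggsLattice.Site.tdist x (centerSite K K₀ i) : ℝ) ≤ 2 * rS P K K₀ := by exact_mod_cast h1
    have h2' : (HiggsLattice.Site.tdist (centerSite K K₀ i) (centerSite K K₀ (ys ⟨t.1, t.2⟩)) : ℝ) ≤ 2 * half P K K₀ * (t.1 + 1) := by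
      exact_mod_cast h2
    have h3' : (HiggsLattice.Site.tdist (centerSite K K₀ (ys t)) y : ℝ) ≤ 2 * half P K K₀ := by exact_mod_cast h3
    have ht' : (2 * rS P K K₀ + 2 * half P K K₀ * ((t : ℕ) + 2) : ℝ) ≤ R := by exact_mod_cast ht
    have et : (ys ⟨t.1, t.2⟩) = ys t := rfl
    rw [et] at h2'
    linarith
  exact_mod_cast h

end Walks

end Literature.MathematicalPhysics.QuantumFieldTheory.Balaban1983to89.B1TorusLabelWalk

end
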